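import Mathlib
import Summits.Ventures.PercRepro2.K5HyperCoeffsB
import Summits.Ventures.PercRepro2.K5HyperTheoremI
import Summits.Ventures.PercRepro2.K5K3Tables

/-!
# THE (ii)- AND (i)-SIDE STAR COMPARISONS AT EVERY MARKING `(0, 1, 2, 3, b)` AS PROFILE SUMS OF p1's KERNELS
(blind cell PercRepro2, typer-1 g12; the dictionary between `K5HyperCoeffsB.lean` and the state kernels
`CaseOne.KII` / `CaseOne.KI` on `K₅` at the marking `(0, 1, 2, 3, b)`, `b : Fin 5` — the same shape as
`K5HyperTheorem.lean` / `K5HyperTheoremI.lean` at `b = 4`)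

`KII_apply_b` / `KI_apply_b`: the kernels at the marks `(0, 1, 2, 3, b)` are the signed products of the tables of
`K5HyperB.lean` (the six tables mentioning `b` through `tL b` / `tH b`; `K5K3Tables.tL_iff` / `tH_iff`).  `NOnB b` /
`NOnIB b` are the masked profile sums (`typedCountHyper`, every edge typed, the profile `k`), `NOnB_eq` / `NOnIB_eq`
the dictionaries (`cPosOnB − cNegOnB`, `cNegOnIB − cPosOnIB`), and from the certificates at the marking `b`:

* **`MB_real`**, **`TvTB_real`**, **`T1B_real`**, **`T2B_real`**: `M(H, T, e) ≥ 0`, `TvT-(ii) ≥ 0`, `0 ≤ N(H + D(1))`,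
  `0 ≤ N(H + D(2))` as profile sums of `KII` at `(0, 1, 2, 3, b)`;
* **`MIB_real`**, **`TvTIB_real`**, **`T1IB_real`**, **`T2IB_real`**: the same for `KI`.
-/

namespace Summit.Ventures.PercRepro2

open Hub

namespace K5

section IndicatorsB

variable {R : Type*} [Field R]

/-- `tH 0 ω ↔ ω ∈ {o ∈ C₂}`. -/
lemma tH_zero_iff (ω : Fin 10 → Bool) : tH 0 ω = true ↔ ω ∈ connEvent ends5 2 0 := by
  unfold tH
  exact conn_iff_mem ω (by norm_num) (by norm_num)

/-- `tQBb b ω ↔ ω ∈ Q ∩ {b ∈ C₂}`. -/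
lemma tQBb_iff (b : Fin 5) (ω : Fin 10 → Bool) :
    tQBb b ω = true ↔ ω ∈ avoidAll ends5 2 {1} ∩ connEvent ends5 2 b := by
  unfold tQBb
  rw [Bool.and_eq_true, tQ_iff, tH_iff]
  exact Iff.rfl

/-- `tABb b ω ↔ ω ∈ Q ∩ {a₃ ∈ C₁} ∩ {b ∈ C₂}`. -/
lemma tABb_iff (b : Fin 5) (ω : Fin 10 → Bool) :
    tABb b ω = true ↔ ω ∈ avoidAll ends5 2 {1} ∩ connEvent ends5 1 3 ∩ connEvent ends5 2 b := by
  unfold tABb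
  rw [Bool.and_eq_true, tA_iff, tH_iff]
  exact Iff.rfl

/-- `tABOb b ω ↔ ω ∈ Q ∩ {a₃ ∈ C₁} ∩ {b ∈ C₂} ∩ {o ∈ C₂}`. -/
lemma tABOb_iff (b : Fin 5) (ω : Fin 10 → Bool) :
    tABOb b ω = true ↔
      ω ∈ avoidAll ends5 2 {1} ∩ connEvent ends5 1 3 ∩ connEvent ends5 2 b ∩ connEvent ends5 2 0 := by
  unfold tABOb
  rw [Bool.and_eq_true, Bool.and_eq_true, tA_iff, tH_iff, tH_zero_iff]
  exact Iff.rfl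

/-- `tQBLb b ω ↔ ω ∈ Q ∩ {b ∈ C₁}`. -/
lemma tQBLb_iff (b : Fin 5) (ω : Fin 10 → Bool) :
    tQBLb b ω = true ↔ ω ∈ avoidAll ends5 2 {1} ∩ connEvent ends5 1 b := by
  unfold tQBLb
  rw [Bool.and_eq_true, tQ_iff, tL_iff]
  exact Iff.rfl

/-- `tABLb b ω ↔ ω ∈ Q ∩ {a₃ ∈ C₁} ∩ {b ∈ C₁}`. -/
lemma tABLb_iff (b : Fin 5) (ω : Fin 10 → Bool) :
    tABLb b ω = true ↔ ω ∈ avoidAll ends5 2 {1} ∩ connEvent ends5 1 3 ∩ connEvent ends5 1 b := by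
  unfold tABLb
  rw [Bool.and_eq_true, tA_iff, tL_iff]
  exact Iff.rfl

/-- `tABOLb b ω ↔ ω ∈ Q ∩ {a₃ ∈ C₁} ∩ {b ∈ C₁} ∩ {o ∈ C₂}`. -/
lemma tABOLb_iff (b : Fin 5) (ω : Fin 10 → Bool) :
    tABOLb b ω = true ↔
      ω ∈ avoidAll ends5 2 {1} ∩ connEvent ends5 1 3 ∩ connEvent ends5 1 b ∩ connEvent ends5 2 0 := by
  unfold tABOLb
  rw [Bool.and_eq_true, Bool.and_eq_true, tA_iff, tL_iff, tH_zero_iff]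
  exact Iff.rfl

/-- `1_QB` at the marking `b` is the table `tQBb b`. -/
lemma iQBb_eq (b : Fin 5) : (CaseOne.iQB ends5 1 2 b : Config (Fin 10) → R) = indR (tQBb b) := by
  unfold CaseOne.iQB
  rw [CovForm.compl_connEvent_eq_Q, Set.inter_comm]
  exact indicator_eq_indR _ (tQBb b) (tQBb_iff b)

/-- `1_AB` at the marking `b` is the table `tABb b`. -/
lemma iABb_eq (b : Fin 5) : (CaseOne.iAB ends5 1 2 3 b : Config (Fin 10) → R) = indR (tABb b) := by
  unfold CaseOne.iAB
  rw [CovForm.compl_connEvent_eq_Q]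
  have : connEvent ends5 2 b ∩ connEvent ends5 1 3 ∩ avoidAll ends5 2 {1} =
      avoidAll ends5 2 {1} ∩ connEvent ends5 1 3 ∩ connEvent ends5 2 b := by
    ext ω; simp only [Set.mem_inter_iff]; tauto
  rw [this]
  exact indicator_eq_indR _ (tABb b) (tABb_iff b)

/-- `1_ABO` at the marking `b` is the table `tABOb b`. -/
lemma iABOb_eq (b : Fin 5) : (CaseOne.iABO ends5 0 1 2 3 b : Config (Fin 10) → R) = indR (tABOb b) := by
  unfold CaseOne.iABO
  rw [CovForm.compl_connEvent_eq_Q]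
  have : connEvent ends5 2 b ∩ connEvent ends5 1 3 ∩ connEvent ends5 2 0 ∩ avoidAll ends5 2 {1} =
      avoidAll ends5 2 {1} ∩ connEvent ends5 1 3 ∩ connEvent ends5 2 b ∩ connEvent ends5 2 0 := by
    ext ω; simp only [Set.mem_inter_iff]; tauto
  rw [this]
  exact indicator_eq_indR _ (tABOb b) (tABOb_iff b)

/-- `1_QB₁` at the marking `b` is the table `tQBLb b`. -/
lemma iQB₁b_eq (b : Fin 5) : (CaseOne.iQB₁ ends5 1 2 b : Config (Fin 10) → R) = indR (tQBLb b) := by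
  unfold CaseOne.iQB₁
  rw [CovForm.compl_connEvent_eq_Q, Set.inter_comm]
  exact indicator_eq_indR _ (tQBLb b) (tQBLb_iff b)

/-- `1_AB₁` at the marking `b` is the table `tABLb b`. -/
lemma iAB₁b_eq (b : Fin 5) : (CaseOne.iAB₁ ends5 1 2 3 b : Config (Fin 10) → R) = indR (tABLb b) := by
  unfold CaseOne.iAB₁
  rw [CovForm.compl_connEvent_eq_Q]
  have : connEvent ends5 1 b ∩ connEvent ends5 1 3 ∩ avoidAll ends5 2 {1} =
      avoidAll ends5 2 {1} ∩ connEvent ends5 1 3 ∩ connEvent ends5 1 b := by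
    ext ω; simp only [Set.mem_inter_iff]; tauto
  rw [this]
  exact indicator_eq_indR _ (tABLb b) (tABLb_iff b)

/-- `1_AB₁O` at the marking `b` is the table `tABOLb b`. -/
lemma iAB₁Ob_eq (b : Fin 5) : (CaseOne.iAB₁O ends5 0 1 2 3 b : Config (Fin 10) → R) = indR (tABOLb b) := by
  unfold CaseOne.iAB₁O
  rw [CovForm.compl_connEvent_eq_Q]
  have : connEvent ends5 1 b ∩ connEvent ends5 1 3 ∩ connEvent ends5 2 0 ∩ avoidAll ends5 2 {1} =
      avoidAll ends5 2 {1} ∩ connEvent ends5 1 3 ∩ connEvent ends5 1 b ∩ connEvent ends5 2 0 := by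
    ext ω; simp only [Set.mem_inter_iff]; tauto
  rw [this]
  exact indicator_eq_indR _ (tABOLb b) (tABOLb_iff b)

/-- **The state kernel on `K₅` at the marking `(0, 1, 2, 3, b)` is the signed product of the eight tables.** -/
lemma KII_apply_b (b : Fin 5) (x y w : Config (Fin 10)) :
    CaseOne.KII (R := R) ends5 0 1 2 3 b x y w =
      indR (tABOb b) x * indR tQ y * indR tPD w + indR (tQBb b) x * indR tPDoU y * indR tA w -
        indR (tQBb b) x * indR tAO y * indR tPD w - indR (tABb b) x * indR tPDoU y * indR tQ w := by
  unfold CaseOne.KII CovForm.sepKernel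
  simp only [Fin.sum_univ_succ, Fin.sum_univ_zero, Matrix.cons_val_zero, Matrix.cons_val_succ,
    add_zero]
  rw [iABOb_eq, iQ_eq, iPDc_eq, iQBb_eq, iPDoU_eq, iA_eq, iAO_eq, iABb_eq]
  ring

/-- **The `(i)`-side state kernel on `K₅` at the marking `(0, 1, 2, 3, b)` is the signed product of the tables.** -/
lemma KI_apply_b (b : Fin 5) (x y w : Config (Fin 10)) :
    CaseOne.KI (R := R) ends5 0 1 2 3 b x y w =
      indR (tQBLb b) x * indR tAO y * indR tPD w + indR (tABLb b) x * indR tPDoU y * indR tQ w -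
        indR (tABOLb b) x * indR tQ y * indR tPD w - indR (tQBLb b) x * indR tPDoU y * indR tA w := by
  unfold CaseOne.KI CovForm.sepKernel
  simp only [Fin.sum_univ_succ, Fin.sum_univ_zero, Matrix.cons_val_zero, Matrix.cons_val_succ,
    add_zero]
  rw [iQB₁b_eq, iAB₁b_eq, iAB₁Ob_eq, iAO_eq, iPDoU_eq, iQ_eq, iPDc_eq, iA_eq]
  ring

end IndicatorsB

section DictionaryB

variable {R : Type*} [Field R] [LinearOrder R] [IsStrictOrderedRing R]

/-- The masked profile sum of the (ii) kernel at the marking `(0, 1, 2, 3, b)`. -/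
noncomputable def NOnB (b : Fin 5) (S₁ S₂ S₃ : Fin 10 → Bool) (k : Fin 10 → Fin 4) : R :=
  typedCountHyper Finset.univ (fun _ => false) (fun e => (k e : ℕ)) S₁ S₂ S₃
    (CaseOne.KII (R := R) ends5 0 1 2 3 b)

/-- The masked profile sum of the (i) kernel at the marking `(0, 1, 2, 3, b)`. -/
noncomputable def NOnIB (b : Fin 5) (S₁ S₂ S₃ : Fin 10 → Bool) (k : Fin 10 → Fin 4) : R :=
  typedCountHyper Finset.univ (fun _ => false) (fun e => (k e : ℕ)) S₁ S₂ S₃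
    (CaseOne.KI (R := R) ends5 0 1 2 3 b)

/-- `N(H + D(1))` at the marking `b`. -/
noncomputable def NT1B (b : Fin 5) (D : Fin 10 → Bool) (k : Fin 10 → Fin 4) : R :=
  rsumT1 (fun S₁ S₂ S₃ => NOnB b S₁ S₂ S₃ k) D

/-- `N(H + D(2))` at the marking `b`. -/
noncomputable def NT2B (b : Fin 5) (D : Fin 10 → Bool) (k : Fin 10 → Fin 4) : R :=
  rsumT2 (fun S₁ S₂ S₃ => NOnB b S₁ S₂ S₃ k) D

/-- `N(H + D(1) + P(1))` at the marking `b`. -/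
noncomputable def NT1e1B (b : Fin 5) (D P : Fin 10 → Bool) (k : Fin 10 → Fin 4) : R :=
  rsumT1e1 (fun S₁ S₂ S₃ => NOnB b S₁ S₂ S₃ k) D P

/-- `N(H + P₁(1) + P₂(1) + P₃(1))` at the marking `b`. -/
noncomputable def NE3B (b : Fin 5) (P₁ P₂ P₃ : Fin 10 → Bool) (k : Fin 10 → Fin 4) : R :=
  rsumE3 (fun S₁ S₂ S₃ => NOnB b S₁ S₂ S₃ k) P₁ P₂ P₃

/-- `N⁽ⁱ⁾(H + D(1))` at the marking `b`. -/
noncomputable def NT1IB (b : Fin 5) (D : Fin 10 → Bool) (k : Fin 10 → Fin 4) : R :=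
  rsumT1 (fun S₁ S₂ S₃ => NOnIB b S₁ S₂ S₃ k) D

/-- `N⁽ⁱ⁾(H + D(2))` at the marking `b`. -/
noncomputable def NT2IB (b : Fin 5) (D : Fin 10 → Bool) (k : Fin 10 → Fin 4) : R :=
  rsumT2 (fun S₁ S₂ S₃ => NOnIB b S₁ S₂ S₃ k) D

/-- `N⁽ⁱ⁾(H + D(1) + P(1))` at the marking `b`. -/
noncomputable def NT1e1IB (b : Fin 5) (D P : Fin 10 → Bool) (k : Fin 10 → Fin 4) : R :=
  rsumT1e1 (fun S₁ S₂ S₃ => NOnIB b S₁ S₂ S₃ k) D P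

/-- `N⁽ⁱ⁾(H + P₁(1) + P₂(1) + P₃(1))` at the marking `b`. -/
noncomputable def NE3IB (b : Fin 5) (P₁ P₂ P₃ : Fin 10 → Bool) (k : Fin 10 → Fin 4) : R :=
  rsumE3 (fun S₁ S₂ S₃ => NOnIB b S₁ S₂ S₃ k) P₁ P₂ P₃

omit [LinearOrder R] [IsStrictOrderedRing R] in
/-- **The dictionary at the marking `b`**: the masked profile sum of `KII` is `cPosOnB b − cNegOnB b`. -/
theorem NOnB_eq (b : Fin 5) (S₁ S₂ S₃ : Fin 10 → Bool) (k : Fin 10 → Fin 4) :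
    NOnB (R := R) b S₁ S₂ S₃ k = ((cPosOnB b S₁ S₂ S₃ k : ℕ) : R) - ((cNegOnB b S₁ S₂ S₃ k : ℕ) : R) := by
  unfold NOnB typedCountHyper
  have hK : (fun x y w => CaseOne.KII (R := R) ends5 0 1 2 3 b (orOn S₁ x) (orOn S₂ y) (orOn S₃ w)) =
      fun x y w =>
        (indR (fun ω => tABOb b (orOn S₁ ω)) x * indR (fun ω => tQ (orOn S₂ ω)) y *
            indR (fun ω => tPD (orOn S₃ ω)) w +
          indR (fun ω => tQBb b (orOn S₁ ω)) x * indR (fun ω => tPDoU (orOn S₂ ω)) y *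
            indR (fun ω => tA (orOn S₃ ω)) w) -
        (indR (fun ω => tQBb b (orOn S₁ ω)) x * indR (fun ω => tAO (orOn S₂ ω)) y *
            indR (fun ω => tPD (orOn S₃ ω)) w +
          indR (fun ω => tABb b (orOn S₁ ω)) x * indR (fun ω => tPDoU (orOn S₂ ω)) y *
            indR (fun ω => tQ (orOn S₃ ω)) w) := by
    funext x y w
    rw [KII_apply_b]
    simp only [indR]
    ring
  rw [hK, typedCount_sub, typedCount_add, typedCount_add]
  simp only [typedCount_tables Finset.univ (fun _ => false) (fun e => (k e : ℕ)) k (profile_univ k)]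
  unfold cPosOnB cNegOnB cOn
  push_cast
  ring

omit [LinearOrder R] [IsStrictOrderedRing R] in
/-- **The dictionary at the marking `b`**: the masked profile sum of `KI` is `cNegOnIB b − cPosOnIB b`. -/
theorem NOnIB_eq (b : Fin 5) (S₁ S₂ S₃ : Fin 10 → Bool) (k : Fin 10 → Fin 4) :
    NOnIB (R := R) b S₁ S₂ S₃ k = ((cNegOnIB b S₁ S₂ S₃ k : ℕ) : R) - ((cPosOnIB b S₁ S₂ S₃ k : ℕ) : R) := by
  unfold NOnIB typedCountHyper
  have hK : (fun x y w => CaseOne.KI (R := R) ends5 0 1 2 3 b (orOn S₁ x) (orOn S₂ y) (orOn S₃ w)) =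
      fun x y w =>
        (indR (fun ω => tQBLb b (orOn S₁ ω)) x * indR (fun ω => tAO (orOn S₂ ω)) y *
            indR (fun ω => tPD (orOn S₃ ω)) w +
          indR (fun ω => tABLb b (orOn S₁ ω)) x * indR (fun ω => tPDoU (orOn S₂ ω)) y *
            indR (fun ω => tQ (orOn S₃ ω)) w) -
        (indR (fun ω => tABOLb b (orOn S₁ ω)) x * indR (fun ω => tQ (orOn S₂ ω)) y *
            indR (fun ω => tPD (orOn S₃ ω)) w +
          indR (fun ω => tQBLb b (orOn S₁ ω)) x * indR (fun ω => tPDoU (orOn S₂ ω)) y *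
            indR (fun ω => tA (orOn S₃ ω)) w) := by
    funext x y w
    rw [KI_apply_b]
    simp only [indR]
    ring
  rw [hK, typedCount_sub, typedCount_add, typedCount_add]
  simp only [typedCount_tables Finset.univ (fun _ => false) (fun e => (k e : ℕ)) k (profile_univ k)]
  unfold cPosOnIB cNegOnIB cOn
  push_cast
  ring

omit [LinearOrder R] [IsStrictOrderedRing R] in
/-- `N(H + D(1)) = csumT1 (cPosOnB b) − csumT1 (cNegOnB b)`. -/
lemma NT1B_eq (b : Fin 5) (D : Fin 10 → Bool) (k : Fin 10 → Fin 4) :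
    NT1B (R := R) b D k = ((csumT1 (cPosOnB b) D k : ℕ) : R) - ((csumT1 (cNegOnB b) D k : ℕ) : R) := by
  unfold NT1B rsumT1 csumT1
  simp only [NOnB_eq]
  push_cast
  ring

omit [LinearOrder R] [IsStrictOrderedRing R] in
/-- `N(H + D(2)) = csumT2 (cPosOnB b) − csumT2 (cNegOnB b)`. -/
lemma NT2B_eq (b : Fin 5) (D : Fin 10 → Bool) (k : Fin 10 → Fin 4) :
    NT2B (R := R) b D k = ((csumT2 (cPosOnB b) D k : ℕ) : R) - ((csumT2 (cNegOnB b) D k : ℕ) : R) := by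
  unfold NT2B rsumT2 csumT2
  simp only [NOnB_eq]
  push_cast
  ring

omit [LinearOrder R] [IsStrictOrderedRing R] in
/-- `N(H + D(1) + P(1)) = csumT1e1 (cPosOnB b) − csumT1e1 (cNegOnB b)`. -/
lemma NT1e1B_eq (b : Fin 5) (D P : Fin 10 → Bool) (k : Fin 10 → Fin 4) :
    NT1e1B (R := R) b D P k =
      ((csumT1e1 (cPosOnB b) D P k : ℕ) : R) - ((csumT1e1 (cNegOnB b) D P k : ℕ) : R) := by
  unfold NT1e1B rsumT1e1 csumT1e1
  simp only [NOnB_eq]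
  push_cast
  ring

omit [LinearOrder R] [IsStrictOrderedRing R] in
/-- `N(H + P₁(1) + P₂(1) + P₃(1)) = csumE3 (cPosOnB b) − csumE3 (cNegOnB b)`. -/
lemma NE3B_eq (b : Fin 5) (P₁ P₂ P₃ : Fin 10 → Bool) (k : Fin 10 → Fin 4) :
    NE3B (R := R) b P₁ P₂ P₃ k =
      ((csumE3 (cPosOnB b) P₁ P₂ P₃ k : ℕ) : R) - ((csumE3 (cNegOnB b) P₁ P₂ P₃ k : ℕ) : R) := by
  unfold NE3B rsumE3 csumE3 csumE3a csumE3b csumE3c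
  simp only [NOnB_eq]
  push_cast
  ring

omit [LinearOrder R] [IsStrictOrderedRing R] in
/-- `N⁽ⁱ⁾(H + D(1)) = csumT1 (cNegOnIB b) − csumT1 (cPosOnIB b)`. -/
lemma NT1IB_eq (b : Fin 5) (D : Fin 10 → Bool) (k : Fin 10 → Fin 4) :
    NT1IB (R := R) b D k = ((csumT1 (cNegOnIB b) D k : ℕ) : R) - ((csumT1 (cPosOnIB b) D k : ℕ) : R) := by
  unfold NT1IB rsumT1 csumT1
  simp only [NOnIB_eq]
  push_cast
  ring

omit [LinearOrder R] [IsStrictOrderedRing R] in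
/-- `N⁽ⁱ⁾(H + D(2)) = csumT2 (cNegOnIB b) − csumT2 (cPosOnIB b)`. -/
lemma NT2IB_eq (b : Fin 5) (D : Fin 10 → Bool) (k : Fin 10 → Fin 4) :
    NT2IB (R := R) b D k = ((csumT2 (cNegOnIB b) D k : ℕ) : R) - ((csumT2 (cPosOnIB b) D k : ℕ) : R) := by
  unfold NT2IB rsumT2 csumT2
  simp only [NOnIB_eq]
  push_cast
  ring

omit [LinearOrder R] [IsStrictOrderedRing R] in
/-- `N⁽ⁱ⁾(H + D(1) + P(1)) = csumT1e1 (cNegOnIB b) − csumT1e1 (cPosOnIB b)`. -/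
lemma NT1e1IB_eq (b : Fin 5) (D P : Fin 10 → Bool) (k : Fin 10 → Fin 4) :
    NT1e1IB (R := R) b D P k =
      ((csumT1e1 (cNegOnIB b) D P k : ℕ) : R) - ((csumT1e1 (cPosOnIB b) D P k : ℕ) : R) := by
  unfold NT1e1IB rsumT1e1 csumT1e1
  simp only [NOnIB_eq]
  push_cast
  ring

omit [LinearOrder R] [IsStrictOrderedRing R] in
/-- `N⁽ⁱ⁾(H + P₁(1) + P₂(1) + P₃(1)) = csumE3 (cNegOnIB b) − csumE3 (cPosOnIB b)`. -/
lemma NE3IB_eq (b : Fin 5) (P₁ P₂ P₃ : Fin 10 → Bool) (k : Fin 10 → Fin 4) :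
    NE3IB (R := R) b P₁ P₂ P₃ k =
      ((csumE3 (cNegOnIB b) P₁ P₂ P₃ k : ℕ) : R) - ((csumE3 (cPosOnIB b) P₁ P₂ P₃ k : ℕ) : R) := by
  unfold NE3IB rsumE3 csumE3 csumE3a csumE3b csumE3c
  simp only [NOnIB_eq]
  push_cast
  ring

/-- **`M(H, T, e) ≥ 0` at the marking `b`: `N(H + D(1)) ≤ N(H + D(1) + P(1))`** from the certificate. -/
theorem MB_real (b : Fin 5) (D P : Fin 10 → Bool) (hc : CertLE (kNegMB b D P) (kPosMB b D P))
    (k : Fin 10 → Fin 4) : NT1B (R := R) b D k ≤ NT1e1B (R := R) b D P k := by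
  have h := cNegMB_le_cPosMB b D P hc k
  unfold cNegMB cPosMB at h
  rw [NT1B_eq, NT1e1B_eq, sub_le_sub_iff]
  exact_mod_cast (by omega :
    csumT1 (cPosOnB b) D k + csumT1e1 (cNegOnB b) D P k ≤ csumT1e1 (cPosOnB b) D P k + csumT1 (cNegOnB b) D k)

/-- **`TvT-(ii) ≥ 0` at the marking `b`: `N(H + T(1)) ≤ N(H + △(1,1,1))`** from the certificate. -/
theorem TvTB_real (b : Fin 5) (x y z : ℕ) (hc : CertLE (kNegTvTB b x y z) (kPosTvTB b x y z))
    (k : Fin 10 → Fin 4) :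
    NT1B (R := R) b (triMask x y z) k ≤ NE3B (R := R) b (pairMask x y) (pairMask x z) (pairMask y z) k := by
  have h := cNegTvTB_le_cPosTvTB b x y z hc k
  unfold cNegTvTB cPosTvTB at h
  rw [NT1B_eq, NE3B_eq, sub_le_sub_iff]
  exact_mod_cast (by omega :
    csumT1 (cPosOnB b) (triMask x y z) k + csumE3 (cNegOnB b) (pairMask x y) (pairMask x z) (pairMask y z) k ≤
      csumE3 (cPosOnB b) (pairMask x y) (pairMask x z) (pairMask y z) k + csumT1 (cNegOnB b) (triMask x y z) k)

/-- **`0 ≤ N(H + D(1))` at the marking `b`** from the certificate. -/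
theorem T1B_real (b : Fin 5) (D : Fin 10 → Bool) (hc : CertLE (sumT1 (negOnB b) D) (sumT1 (posOnB b) D))
    (k : Fin 10 → Fin 4) : 0 ≤ NT1B (R := R) b D k := by
  rw [NT1B_eq, sub_nonneg]
  exact_mod_cast cT1B_le b D hc k

/-- **`0 ≤ N(H + D(2))` at the marking `b`** from the certificate. -/
theorem T2B_real (b : Fin 5) (D : Fin 10 → Bool) (hc : CertLE (sumT2 (negOnB b) D) (sumT2 (posOnB b) D))
    (k : Fin 10 → Fin 4) : 0 ≤ NT2B (R := R) b D k := by
  rw [NT2B_eq, sub_nonneg]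
  exact_mod_cast cT2B_le b D hc k

/-- **`M-(i) ≥ 0` at the marking `b`: `N⁽ⁱ⁾(H + D(1)) ≤ N⁽ⁱ⁾(H + D(1) + P(1))`** from the certificate. -/
theorem MIB_real (b : Fin 5) (D P : Fin 10 → Bool) (hc : CertLE (kNegMIB b D P) (kPosMIB b D P))
    (k : Fin 10 → Fin 4) : NT1IB (R := R) b D k ≤ NT1e1IB (R := R) b D P k := by
  have h := cNegMIB_le_cPosMIB b D P hc k
  unfold cNegMIB cPosMIB at h
  rw [NT1IB_eq, NT1e1IB_eq, sub_le_sub_iff]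
  exact_mod_cast (by omega :
    csumT1 (cNegOnIB b) D k + csumT1e1 (cPosOnIB b) D P k ≤ csumT1e1 (cNegOnIB b) D P k + csumT1 (cPosOnIB b) D k)

/-- **`TvT-(i) ≥ 0` at the marking `b`: `N⁽ⁱ⁾(H + T(1)) ≤ N⁽ⁱ⁾(H + △(1,1,1))`** from the certificate. -/
theorem TvTIB_real (b : Fin 5) (x y z : ℕ) (hc : CertLE (kNegTvTIB b x y z) (kPosTvTIB b x y z))
    (k : Fin 10 → Fin 4) :
    NT1IB (R := R) b (triMask x y z) k ≤ NE3IB (R := R) b (pairMask x y) (pairMask x z) (pairMask y z) k := by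
  have h := cNegTvTIB_le_cPosTvTIB b x y z hc k
  unfold cNegTvTIB cPosTvTIB at h
  rw [NT1IB_eq, NE3IB_eq, sub_le_sub_iff]
  exact_mod_cast (by omega :
    csumT1 (cNegOnIB b) (triMask x y z) k + csumE3 (cPosOnIB b) (pairMask x y) (pairMask x z) (pairMask y z) k ≤
      csumE3 (cNegOnIB b) (pairMask x y) (pairMask x z) (pairMask y z) k + csumT1 (cPosOnIB b) (triMask x y z) k)

/-- **`0 ≤ N⁽ⁱ⁾(H + D(1))` at the marking `b`** from the certificate. -/
theorem T1IB_real (b : Fin 5) (D : Fin 10 → Bool) (hc : CertLE (sumT1 (posOnIB b) D) (sumT1 (negOnIB b) D))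
    (k : Fin 10 → Fin 4) : 0 ≤ NT1IB (R := R) b D k := by
  rw [NT1IB_eq, sub_nonneg]
  exact_mod_cast cT1IB_le b D hc k

/-- **`0 ≤ N⁽ⁱ⁾(H + D(2))` at the marking `b`** from the certificate. -/
theorem T2IB_real (b : Fin 5) (D : Fin 10 → Bool) (hc : CertLE (sumT2 (posOnIB b) D) (sumT2 (negOnIB b) D))
    (k : Fin 10 → Fin 4) : 0 ≤ NT2IB (R := R) b D k := by
  rw [NT2IB_eq, sub_nonneg]
  exact_mod_cast cT2IB_le b D hc k

end DictionaryB

end K5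

end Summit.Ventures.PercRepro2
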